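import Mathlib.Algebra.MvPolynomial.CommRing
import Mathlib.RingTheory.MvPolynomial.WeightedHomogeneous
import Mathlib.RingTheory.Polynomial.Basic
import Mathlib.Tactic.Linarith
import Mathlib.Tactic.Ring
import HarnessLib

/-!
# The strict weight ideal and the `RZ` endgame (instrument for the `W(f)` toy model — NOT a resolution theorem)

Generic commutative algebra (ours, bookkeeping over [Matsumura1987, §27] and [Lang2002, Ch. IV §1]) closing the
last line of the engine's "THEOREM RZ" (cell notes RE-DERIVATION-eng1-g41 §3.7.4):

* `gtIdeal zw c` : for `ℕ`-valued variable weights `zw`, the polynomials all of whose monomials have `zw`-weight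
  `> c` form an IDEAL of `MvPolynomial ι K` (`mem_gtIdeal_iff`, `mem_gtIdeal_of_le`);
* `eq_zero_of_isWeightedHomogeneous_of_mem_gtIdeal` : a weighted-homogeneous polynomial of weight `w ≤ c` lying in
  `gtIdeal zw c` is `0`;
* `eq_zero_of_C_mul_pow_mem_gtIdeal` : over a domain, `c ≠ 0`, `α` homogeneous of weight `e`, `n ≠ 0` and
  `C c * α ^ n ∈ gtIdeal zw (n * e)` force `α = 0`;
* `lt_weight_RZ` : the arithmetic of `(★)`: `l < p`, `d* < p d₁` ⇒ `p d* < (p² − p l) d₁ + l d*`;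
* `eq_zero_of_C_mul_pow_eq_neg_sum` : THE ENDGAME — if `C c * α ^ p = - Σ_{l<p} Ψ l` where every monomial of `Ψ l`
  has weight `≥ (p² − p l) d₁ + l d*`, `α` is homogeneous of weight `d*`, `d* < p d₁`, `c ≠ 0`, `p ≠ 0`, then
  `α = 0` ("the `Z`-weight-`p d*` component of `(E_{p²})` reads `c₁ α^p = 0`").

Dictionary (not imported, so that this file builds on Mathlib alone): the two displayed hypotheses of the endgame are
exactly the conclusions of `MonomialCurve.mul_pow_eq_neg_sum` (with `H = C c`) and of `MonomialCurve.filt_multiShift`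
(with `n = 0`, `pw = ![d₁, d*]`, read through `MonomialCurve.weight_fin_two`) of the cell's file
`WeightedCentreMonomialCurve.lean`; `gtIdeal zw c` is the ideal `{f | LeadingForm.WtGE zw (c+1) f}` of
`WeightedCentreLeadingForm.lean`.

VALUE: bookkeeping for a toy model (Resolution Observatory cell `pub-rosobs`, carver lane gen 62; AI-written Lean, and
AI review is weaker than expert review); nothing here is specific to resolution of singularities, NOT a statement
about the invariant of [AbramovichTemkinWlodarczyk2024], NOT progress on the summit.
-/

namespace Literature.AlgebraicGeometry.Resolution.WeightedBlowup

namespace StrictWeightIdeal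

open MvPolynomial
open scoped Pointwise

variable {K : Type*} [CommRing K] {ι : Type*}

/-- (ours, bookkeeping) The strict weight ideal: polynomials all of whose monomials have `zw`-weight `> c`.
[cite: Matsumura1987, §27 (p. 207)] -/
def gtIdeal (zw : ι → ℕ) (c : ℕ) : Ideal (MvPolynomial ι K) where
  carrier := {f | ∀ m ∈ f.support, c < Finsupp.weight zw m}
  zero_mem' := fun m hm => by simp at hm
  add_mem' {f g} hf hg := fun m hm => by
    classical
    rcases Finset.mem_union.1 (support_add hm) with h | h
    exacts [hf m h, hg m h]
  smul_mem' g f hf := fun m hm => by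
    classical
    rw [smul_eq_mul] at hm
    obtain ⟨m₁, -, m₂, hm₂, rfl⟩ := Finset.mem_add.1 (support_mul _ _ hm)
    rw [map_add]
    exact (hf m₂ hm₂).trans_le (Nat.le_add_left _ _)

/-- (ours, bookkeeping) Membership in the strict weight ideal. [cite: Matsumura1987, §27 (p. 207)] -/
@[simp] theorem mem_gtIdeal_iff (zw : ι → ℕ) (c : ℕ) (f : MvPolynomial ι K) :
    f ∈ gtIdeal zw c ↔ ∀ m ∈ f.support, c < Finsupp.weight zw m :=
  Iff.rfl

/-- (ours, bookkeeping) The strict weight ideals decrease in `c`. [cite: Matsumura1987, §27 (p. 207)] -/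
theorem gtIdeal_antitone (zw : ι → ℕ) : Antitone (gtIdeal (K := K) zw) :=
  fun _ _ h _ hf m hm => h.trans_lt (hf m hm)

/-- (ours, bookkeeping) A polynomial all of whose monomials have weight `≥ b` with `c < b` lies in `gtIdeal zw c`.
[cite: Matsumura1987, §27 (p. 207)] -/
theorem mem_gtIdeal_of_le (zw : ι → ℕ) {c b : ℕ} (hcb : c < b) {f : MvPolynomial ι K}
    (hf : ∀ m ∈ f.support, b ≤ Finsupp.weight zw m) : f ∈ gtIdeal zw c :=
  fun m hm => hcb.trans_le (hf m hm)

/-- (ours, bookkeeping) A weighted-homogeneous polynomial of weight `w ≤ c` in `gtIdeal zw c` vanishes.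
[cite: Matsumura1987, §27 (p. 207)] -/
theorem eq_zero_of_isWeightedHomogeneous_of_mem_gtIdeal (zw : ι → ℕ) {f : MvPolynomial ι K} {w c : ℕ}
    (hf : IsWeightedHomogeneous zw f w) (hwc : w ≤ c) (hmem : f ∈ gtIdeal zw c) : f = 0 := by
  classical
  by_contra hne
  obtain ⟨m, hm⟩ := Finset.nonempty_iff_ne_empty.2 (fun h => hne (support_eq_empty.1 h))
  have h1 : Finsupp.weight zw m = w := hf (mem_support_iff.1 hm)
  have h2 : c < Finsupp.weight zw m := hmem m hm
  omega

/-- (ours, bookkeeping) Over a domain: `c ≠ 0`, `α` homogeneous of weight `e`, `n ≠ 0` and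
`C c * α ^ n ∈ gtIdeal zw (n * e)` force `α = 0`. [cite: Matsumura1987, §27 (p. 207)] -/
theorem eq_zero_of_C_mul_pow_mem_gtIdeal [IsDomain K] (zw : ι → ℕ) {c : K} (hc : c ≠ 0)
    {α : MvPolynomial ι K} {e n : ℕ} (hn : n ≠ 0) (hα : IsWeightedHomogeneous zw α e)
    (hmem : C c * α ^ n ∈ gtIdeal zw (n * e)) : α = 0 := by
  have hhom : IsWeightedHomogeneous zw (C c * α ^ n) (n * e) := by
    simpa only [smul_eq_mul] using (hα.pow n).C_mul c
  have h0 := eq_zero_of_isWeightedHomogeneous_of_mem_gtIdeal zw hhom le_rfl hmem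
  rcases mul_eq_zero.1 h0 with h | h
  · exact absurd ((C_eq_zero).1 h) hc
  · exact (pow_eq_zero_iff hn).1 h

/-- (ours, bookkeeping) The arithmetic of `(★)` in THEOREM RZ: `l < p` and `d* < p d₁` give
`p d* < (p² − p l) d₁ + l d*`. [cite: Lang2002, Ch. IV §1] -/
theorem lt_weight_RZ {p l d₁ e : ℕ} (hl : l < p) (he : e < p * d₁) :
    p * e < (p * p - p * l) * d₁ + l * e := by
  obtain ⟨k, rfl⟩ := Nat.exists_eq_add_of_lt hl
  have h1 : (l + k + 1) * (l + k + 1) - (l + k + 1) * l = (l + k + 1) * (k + 1) := by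
    rw [Nat.sub_eq_iff_eq_add (Nat.mul_le_mul_left _ (by omega))]
    ring
  rw [h1]
  have h2 : (k + 1) * (e + 1) ≤ (k + 1) * ((l + k + 1) * d₁) := Nat.mul_le_mul_left _ he
  nlinarith [h2]

/-- (ours, bookkeeping) THE `RZ` ENDGAME.  If `C c * α ^ p = - Σ_{l<p} Ψ l` where every monomial of `Ψ l` has
`zw`-weight `≥ (p² − p l) d₁ + l d*`, `α` is `zw`-homogeneous of weight `d*`, `d* < p d₁`, `c ≠ 0` and `p ≠ 0`
(over a domain `K`), then `α = 0`. [cite: Lang2002, Ch. IV §1] -/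
theorem eq_zero_of_C_mul_pow_eq_neg_sum [IsDomain K] (zw : ι → ℕ) {p d₁ dstar : ℕ} (hp : p ≠ 0)
    (hstar : dstar < p * d₁) {c : K} (hc : c ≠ 0) {α : MvPolynomial ι K}
    (hα : IsWeightedHomogeneous zw α dstar) (Ψ : ℕ → MvPolynomial ι K)
    (hΨ : ∀ l < p, ∀ m ∈ (Ψ l).support, (p * p - p * l) * d₁ + l * dstar ≤ Finsupp.weight zw m)
    (hsum : C c * α ^ p = - ∑ l ∈ Finset.range p, Ψ l) : α = 0 := by
  refine eq_zero_of_C_mul_pow_mem_gtIdeal zw hc hp hα ?_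
  rw [hsum]
  refine (gtIdeal zw (p * dstar)).neg_mem ((gtIdeal zw (p * dstar)).sum_mem fun l hl => ?_)
  have hl : l < p := Finset.mem_range.1 hl
  exact mem_gtIdeal_of_le zw (lt_weight_RZ hl hstar) (hΨ l hl)

/-- (ours, bookkeeping) Ideal form of the endgame: it suffices that `C c * α ^ p` lie in the ideal generated by the
`Ψ l`, `l < p` (e.g. `C c * α ^ p ∈ I` for every ideal `I` containing them). [cite: Lang2002, Ch. IV §1] -/
theorem eq_zero_of_C_mul_pow_mem_span [IsDomain K] (zw : ι → ℕ) {p d₁ dstar : ℕ} (hp : p ≠ 0)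
    (hstar : dstar < p * d₁) {c : K} (hc : c ≠ 0) {α : MvPolynomial ι K}
    (hα : IsWeightedHomogeneous zw α dstar) (Ψ : ℕ → MvPolynomial ι K)
    (hΨ : ∀ l < p, ∀ m ∈ (Ψ l).support, (p * p - p * l) * d₁ + l * dstar ≤ Finsupp.weight zw m)
    (hmem : C c * α ^ p ∈ Ideal.span (Ψ '' ↑(Finset.range p))) : α = 0 := by
  refine eq_zero_of_C_mul_pow_mem_gtIdeal zw hc hp hα ?_
  refine (Ideal.span_le.2 ?_) hmem
  rintro _ ⟨l, hl, rfl⟩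
  have hl : l < p := Finset.mem_range.1 (Finset.mem_coe.1 hl)
  exact mem_gtIdeal_of_le zw (lt_weight_RZ hl hstar) (hΨ l hl)

/-! ## Smoke test -/

section SmokeTest

/- `p = 3`, `d₁ = 1`, `d* = 2 < 3`: the weight thresholds `(9 - 3 l) + 2 l` for `l = 0, 1, 2` are `9, 8, 7 > 6`. -/
example : 3 * 2 < (3 * 3 - 3 * 2) * 1 + 2 * 2 := lt_weight_RZ (by norm_num) (by norm_num)

/- One variable of weight `1`: `X` is homogeneous of weight `1`, and `2 • X ^ 3 ∈ gtIdeal _ 3` is impossible. -/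
example (α : MvPolynomial Unit ℚ) (hα : IsWeightedHomogeneous (fun _ => 1) α 1)
    (h : C (2 : ℚ) * α ^ 3 ∈ gtIdeal (fun _ : Unit => 1) (3 * 1)) : α = 0 :=
  eq_zero_of_C_mul_pow_mem_gtIdeal _ (by norm_num) (by norm_num) hα h

end SmokeTest

end StrictWeightIdeal

end Literature.AlgebraicGeometry.Resolution.WeightedBlowup
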